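import Mathlib
import Summits.NavierStokesRegularity.NavierStokesRegularity.Theses.RotatedEulerWindow
import HarnessLib

/-!
# `RotatedEulerWindow.Assembly` — the route's assembly (item stmt-NavierStokesRegularity-19282; pure
  logic)

**Statement.** `RotatedWindowCore → EmptyEulerWindow → EmptyRotatedEulerWindow → NoTypeIBlowup →
NoBlowupToClay → Clay`.

PROOF. The route file `Theses/RotatedEulerWindow.lean` carries the planner-authored, kernel-checked
deciding theorem `Theses.RotatedEulerWindow.closes`, whose hypotheses are exactly the route's items
and whose conclusion is the registered leaf; the assembly item is that implication written as ONE
proposition, so it is closed by applying `closes` to the hypotheses.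

HONEST FRAMING: glue between the route's own statements (about HYPOTHETICAL objects); nothing
here bears on the regularity problem itself.
-/

noncomputable section

set_option linter.dupNamespace false

namespace Summit.NavierStokesRegularity.NavierStokesRegularity.Theorems

open Summit.NavierStokesRegularity.NavierStokesRegularity.Theses.RotatedEulerWindow in
/-- **Item stmt-NavierStokesRegularity-19282** (`RotatedEulerWindow.Assembly`): the route's chain of
items implies its registered leaf, by the route file's deciding theorem `closes`. [this file] -/
theorem rotatedEulerWindow_assembly_proof :
    Summit.NavierStokesRegularity.NavierStokesRegularity.Theses.RotatedEulerWindow.Assembly := by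
  unfold Summit.NavierStokesRegularity.NavierStokesRegularity.Theses.RotatedEulerWindow.Assembly
  intro h₁ h₂ h₃ h₄ h₅
  exact closes h₁ h₂ h₃ h₄ h₅

end Summit.NavierStokesRegularity.NavierStokesRegularity.Theorems

end
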